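import Summits.NavierStokesRegularity.NavierStokesRegularity.Theorems.TypeICertificateLadderTargetNormalVelocityRung
import HarnessLib

/-!
# Crux `Target` = `TypeICertificateLadder.NoTypeIBlowup` (stmt-NavierStokesRegularity-1217), line
# `depletion-ladder`: THE VORTICITY-SIDE CHANNELS OF ENSTROPHY PRODUCTION, I — only the LONGITUDINAL
# derivative `∂_ξ ω` produces enstrophy (transport form); transversal gradients of `ω` are blind

`--supports stmt-NavierStokesRegularity-1217` (helper; kinematics file 1 of 3). Author: STA lineage `ns-sta-19551-p1` (g12).

The stretching integral `J = ∫⟪ω, Dv ω⟫` (`ω = curl v`) has two exact forms pairing the undifferentiated velocity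
with a field built from `ω` alone: the LAMB form `J = ∫⟪v, ω × curl ω⟫` (g6, `integral_stretching_eq_integral_inner_cross`)
and the TRANSPORT form `J = −∫⟪Dω ω, v⟫` (this file, `integral_stretching_eq_neg_integral_inner_convect`: one
integration by parts with `div ω = 0`, no cut-offs — Mathlib's `integral_bilinear_fderiv_right_eq_neg_left_of_integrable`
coordinatewise on the slice class `v ∈ C²`, `|v| ≤ M`, `‖Dv‖ ≤ B`, `ω, |∇ω|_F ∈ L²`). Writing `ω = |ω|ξ`:
`Dω ω = |ω|·∂_ξω` with `∂_ξω = (∂_ξ|ω|)ξ + |ω|κn` (`κn = ∂_ξξ`, the curvature vector of the vortex line), so ONLY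
THE VARIATION OF `ω` ALONG ITS OWN LINE produces enstrophy:

* `abs_integral_stretching_le_longitudinal` — `|∫J| ≤ M · ‖ω‖₂ · ‖∂_ξω‖₂`, `‖∂_ξω‖₂² := ∫‖Dω ω‖²/‖ω‖²`;
* `integral_longitudinalSq_le` — `‖∂_ξω‖₂² ≤ ‖∇ω‖₂²` (one column of the gradient);
* `sq_integral_stretching_le_longitudinal` — **`R² ≤ L`** for S1's depletion ratio `R = ∫J/(M‖ω‖₂‖∇ω‖₂)` (numerics
  `κ̂ ≈ 0.145`) and the LONGITUDINAL PALINSTROPHY FRACTION `L = ‖∂_ξω‖₂²/‖∇ω‖₂² ∈ [0,1]`.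

Straight vortex lines with `|ω|` constant along them (every 2½-D field `ω = f(x₁,x₂)e₃`) have `∂_ξω ≡ 0`, hence
`J = 0` EXACTLY — the quantitative form of «no vortex stretching in 2-D». Companion files: II (`…ChannelsTwist`:
the Lamb channel `ξ × curl ω`, twist is blind, `R² + τ ≤ 1`) and III (`…ChannelsRung`: the flow-wise rungs and the
Type-I portraits «a Type-I blow-up at rate `C` keeps `L(t) > C⁻²` and `τ(t) < 1 − C⁻²` at times accumulating at
`T`»). Together with g6 (`curl ω ∥ v` blind, `R² + A ≤ 1`) and g11 (`v ∥ ω` blind, normal-velocity rung) this is the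
complete census of blind components of the trilinear density `⟪curl ω, v × ω⟫ = det[v, ω, curl ω]` and of its
transport twin `−⟪v, |ω|∂_ξω⟫`. WHAT THIS IS NOT: no universal constant below `(9+2√15)/42`; kinematics only;
nothing on Type II. [folklore]

References: P. Constantin, Comm. Math. Phys. 129 (1990) 241–266, (2.9)–(2.11) (stretching via `ξ`, `α = ξ·Sξ`);
P. Constantin, SIAM Rev. 36 (1994) 73–98 (geometric depletion); Majda–Bertozzi (2002) §1.1, §1.2.
-/

noncomputable section

open Set Filter Topology MeasureTheory
open scoped RealInnerProductSpace ENNReal NNReal ContDiff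
open Literature.Analysis.FluidPDE

namespace Summit.NavierStokesRegularity.NavierStokesRegularity.Theorems.DepletionLadder

-- the problem directory repeats the summit name (`NavierStokesRegularity/NavierStokesRegularity`)
set_option linter.dupNamespace false

open Summit.NavierStokesRegularity.NavierStokesRegularity.Theorems.RungReynoldsOne
open Summit.NavierStokesRegularity.NavierStokesRegularity.Theorems.RungReynoldsOne.WeightedSlice

namespace Channels

/-! ## Pointwise algebra -/

/-- First coordinate of the cross product. [folklore] -/
private theorem cross_apply_zero (a c : (EuclideanSpace ℝ (Fin 3))) : cross a c 0 = a 1 * c 2 - a 2 * c 1 := by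
  simp [cross, cross_apply]

/-- Second coordinate of the cross product. [folklore] -/
private theorem cross_apply_one (a c : (EuclideanSpace ℝ (Fin 3))) : cross a c 1 = a 2 * c 0 - a 0 * c 2 := by
  simp [cross, cross_apply]

/-- Third coordinate of the cross product. [folklore] -/
private theorem cross_apply_two (a c : (EuclideanSpace ℝ (Fin 3))) : cross a c 2 = a 0 * c 1 - a 1 * c 0 := by
  simp [cross, cross_apply]

/-- The inner product of `ℝ³` in coordinates. [folklore] -/
private theorem inner_fin_three (p q : (EuclideanSpace ℝ (Fin 3))) : ⟪p, q⟫ = p 0 * q 0 + p 1 * q 1 + p 2 * q 2 := by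
  simp [PiLp.inner_apply, Fin.sum_univ_three, mul_comm]

/-- Lagrange's identity `‖a × c‖² = ‖a‖²‖c‖² − ⟪a, c⟫²`. [folklore] -/
theorem norm_cross_sq_eq_sub (a c : (EuclideanSpace ℝ (Fin 3))) : ‖cross a c‖ ^ 2 = ‖a‖ ^ 2 * ‖c‖ ^ 2 - ⟪a, c⟫ ^ 2 := by
  rw [← real_inner_self_eq_norm_sq (cross a c), ← real_inner_self_eq_norm_sq a,
    ← real_inner_self_eq_norm_sq c, inner_fin_three, inner_fin_three, inner_fin_three, inner_fin_three,
    cross_apply_zero, cross_apply_one, cross_apply_two]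
  ring

/-- **Twist is blind (pointwise).** `‖a × c‖²/‖a‖² ≤ ‖c‖² − ⟪a, c⟫²/‖a‖²`: the transversal part of `c`
relative to the direction of `a` (equality where `a ≠ 0`; at `a = 0` the left side is `0`). [folklore] -/
theorem norm_cross_sq_div_le (a c : (EuclideanSpace ℝ (Fin 3))) :
    ‖cross a c‖ ^ 2 / ‖a‖ ^ 2 ≤ ‖c‖ ^ 2 - ⟪a, c⟫ ^ 2 / ‖a‖ ^ 2 := by
  by_cases ha : a = 0
  · subst ha; simp
  · have h0 : 0 < ‖a‖ ^ 2 := by positivity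
    rw [norm_cross_sq_eq_sub, sub_div, mul_div_cancel_left₀ _ h0.ne']

/-- **Transversal gradients are blind (pointwise).** `‖Dω(x) ω(x)‖²/‖ω(x)‖² ≤ ‖Dω(x)‖² ≤ |Dω(x)|²_F`: the
longitudinal derivative `∂_ξω = Dω ξ` is one column of the gradient. [folklore] -/
theorem norm_apply_self_sq_div_le (L : (EuclideanSpace ℝ (Fin 3)) →L[ℝ] (EuclideanSpace ℝ (Fin 3))) (a : (EuclideanSpace ℝ (Fin 3))) :
    ‖L a‖ ^ 2 / ‖a‖ ^ 2 ≤ frobeniusNormSq L := by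
  refine le_trans ?_ (sq_opNorm_le_frobeniusNormSq L)
  by_cases ha : a = 0
  · subst ha; simp
  · have h0 : 0 < ‖a‖ ^ 2 := by positivity
    rw [div_le_iff₀ h0, ← mul_pow]
    exact pow_le_pow_left₀ (norm_nonneg _) (L.le_opNorm a) 2

/-- `‖L a‖ = ‖a‖ · (‖L a‖/‖a‖)` (trivial bookkeeping, also at `a = 0`). [folklore] -/
theorem norm_apply_eq_norm_mul_div (L : (EuclideanSpace ℝ (Fin 3)) →L[ℝ] (EuclideanSpace ℝ (Fin 3))) (a : (EuclideanSpace ℝ (Fin 3))) :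
    ‖L a‖ = ‖a‖ * (‖L a‖ / ‖a‖) := by
  by_cases ha : a = 0
  · subst ha; simp
  · rw [mul_div_cancel₀ _ (norm_ne_zero_iff.2 ha)]

/-- `‖a × c‖ = ‖a‖ · (‖a × c‖/‖a‖)` (also at `a = 0`, where `a × c = 0`). [folklore] -/
theorem norm_cross_eq_norm_mul_div (a c : (EuclideanSpace ℝ (Fin 3))) :
    ‖cross a c‖ = ‖a‖ * (‖cross a c‖ / ‖a‖) := by
  by_cases ha : a = 0
  · subst ha
    have : cross (0 : (EuclideanSpace ℝ (Fin 3))) c = 0 := by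
      ext i; fin_cases i <;> simp [cross_apply_zero, cross_apply_one, cross_apply_two]
    simp [this]
  · rw [mul_div_cancel₀ _ (norm_ne_zero_iff.2 ha)]

/-! ## The transport form of the stretching integral -/

variable {v : (EuclideanSpace ℝ (Fin 3)) → (EuclideanSpace ℝ (Fin 3))}

/-- **Transport form** of the stretching integral (one integration by parts, no cut-offs). For `v ∈ C²(ℝ³; ℝ³)`
bounded with bounded gradient and `ω = curl v ∈ L²`, `|∇ω|_F ∈ L²`:
`∫⟪ω, Dv ω⟫ = −∫⟪Dω ω, v⟫` (and the right integrand is integrable), because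
`⟪ω, Dv ω⟫ = Σⱼ ⟪ωⱼ ω, ∂ⱼv⟫` and `Σⱼ ∂ⱼ(ωⱼ ω) = (div ω) ω + Dω ω = Dω ω` (Mathlib's
`integral_bilinear_fderiv_right_eq_neg_left_of_integrable` coordinatewise; the three pairings are dominated by
`2M‖ω‖‖Dω‖`, `B‖ω‖²`, `M‖ω‖²`). Since `Dω ω = |ω| ∂_ξω`, ONLY THE LONGITUDINAL DERIVATIVE of the vorticity
produces enstrophy. [folklore] -/
theorem integral_stretching_eq_neg_integral_inner_convect (hv : ContDiff ℝ 2 v) {M B : ℝ}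
    (hM : ∀ x, ‖v x‖ ≤ M) (hB : ∀ x, ‖fderiv ℝ v x‖ ≤ B)
    (iZ : Integrable (fun x => ‖curl v x‖ ^ 2))
    (iA : Integrable (fun x => frobeniusNormSq (fderiv ℝ (curl v) x))) :
    Integrable (fun x => ⟪fderiv ℝ (curl v) x (curl v x), v x⟫) ∧
    ∫ x, ⟪curl v x, fderiv ℝ v x (curl v x)⟫ = -∫ x, ⟪fderiv ℝ (curl v) x (curl v x), v x⟫ := by
  set e := EuclideanSpace.basisFun (Fin 3) ℝ with he
  have he1 : ∀ i, ‖e i‖ = 1 := fun i => by simp [he]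
  set w : (EuclideanSpace ℝ (Fin 3)) → (EuclideanSpace ℝ (Fin 3)) := curl v with hwdef
  have hv1 : ContDiff ℝ 1 v := hv.of_le (by norm_num)
  have hw1 : ContDiff ℝ 1 w := contDiff_one_curl_of_contDiff_two hv
  have hdw : Differentiable ℝ w := hw1.differentiable one_ne_zero
  have hdv : Differentiable ℝ v := hv1.differentiable one_ne_zero
  have hdivw : ∀ x, VectorCalculus.divergence w x = 0 := fun x => divergence_curl_eq_zero_holds v hv x
  have hfs : ∀ j, ContDiff ℝ 1 (fun y => ⟪e j, w y⟫ • w y) := fun j =>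
    (contDiff_const.inner ℝ hw1).smul hw1
  have hdf : ∀ j, Differentiable ℝ (fun y => ⟪e j, w y⟫ • w y) := fun j =>
    (hfs j).differentiable one_ne_zero
  have cv : Continuous v := hv.continuous
  have cw : Continuous w := hw1.continuous
  have cDw : Continuous (fderiv ℝ w) := hw1.continuous_fderiv one_ne_zero
  have cdv : ∀ i, Continuous fun x => fderiv ℝ v x (e i) := fun i =>
    (hv1.continuous_fderiv one_ne_zero).clm_apply continuous_const
  have cf : ∀ j, Continuous (fun y => ⟪e j, w y⟫ • w y) := fun j => (hfs j).continuous
  have cdf : ∀ j, Continuous fun x => fderiv ℝ (fun y => ⟪e j, w y⟫ • w y) x (e j) := fun j =>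
    ((hfs j).continuous_fderiv one_ne_zero).clm_apply continuous_const
  -- the derivative of `wⱼ w`
  have hdfj : ∀ j x, fderiv ℝ (fun y => ⟪e j, w y⟫ • w y) x (e j) =
      ⟪e j, fderiv ℝ w x (e j)⟫ • w x + ⟪e j, w x⟫ • fderiv ℝ w x (e j) := fun j x =>
    fderiv_inner_smul_apply hw1 (hdw x) (e j) (e j)
  -- `L²` data
  have mw : MemLp (fun x => ‖w x‖) 2 volume := memLp_two_norm_curl hv iZ
  have mD : MemLp (fun x => ‖fderiv ℝ w x‖) 2 volume := by
    refine (memLp_two_iff_integrable_sq cDw.norm.aestronglyMeasurable).2 ?_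
    exact iA.mono' (cDw.norm.pow 2).aestronglyMeasurable (Eventually.of_forall fun x => by
      rw [Real.norm_of_nonneg (sq_nonneg _)]; exact sq_opNorm_le_frobeniusNormSq _)
  have iwD : Integrable (fun x => ‖w x‖ * ‖fderiv ℝ w x‖) := mw.integrable_mul mD
  have hM0 : 0 ≤ M := (norm_nonneg _).trans (hM 0)
  have hB0 : 0 ≤ B := (norm_nonneg _).trans (hB 0)
  -- pointwise bounds
  have hei : ∀ i (y : (EuclideanSpace ℝ (Fin 3))), ‖⟪e i, y⟫‖ ≤ ‖y‖ := fun i y =>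
    (norm_inner_le_norm (𝕜 := ℝ) (e i) y).trans (by rw [he1, one_mul])
  have hdwi : ∀ x i, ‖fderiv ℝ w x (e i)‖ ≤ ‖fderiv ℝ w x‖ := fun x i =>
    ((fderiv ℝ w x).le_opNorm (e i)).trans (by rw [he1, mul_one])
  have nf : ∀ j x, ‖⟪e j, w x⟫ • w x‖ ≤ ‖w x‖ * ‖w x‖ := fun j x => by
    rw [norm_smul]; exact mul_le_mul_of_nonneg_right (hei j (w x)) (norm_nonneg _)
  have ndf : ∀ j x, ‖fderiv ℝ (fun y => ⟪e j, w y⟫ • w y) x (e j)‖ ≤ 2 * (‖w x‖ * ‖fderiv ℝ w x‖) :=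
    fun j x => by
    rw [hdfj j x]
    have t1 : ‖⟪e j, fderiv ℝ w x (e j)⟫ • w x‖ ≤ ‖fderiv ℝ w x‖ * ‖w x‖ := by
      rw [norm_smul]
      exact mul_le_mul_of_nonneg_right ((hei j _).trans (hdwi x j)) (norm_nonneg _)
    have t2 : ‖⟪e j, w x⟫ • fderiv ℝ w x (e j)‖ ≤ ‖w x‖ * ‖fderiv ℝ w x‖ := by
      rw [norm_smul]; exact mul_le_mul (hei j _) (hdwi x j) (norm_nonneg _) (norm_nonneg _)
    calc _ ≤ _ := norm_add_le _ _
      _ ≤ ‖fderiv ℝ w x‖ * ‖w x‖ + ‖w x‖ * ‖fderiv ℝ w x‖ := add_le_add t1 t2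
      _ = 2 * (‖w x‖ * ‖fderiv ℝ w x‖) := by ring
  -- integrability of the three pairings of the integration by parts
  have s1 : ∀ j, Integrable (fun x => ⟪fderiv ℝ (fun y => ⟪e j, w y⟫ • w y) x (e j), v x⟫) volume :=
    fun j => by
    refine (iwD.const_mul (2 * M)).mono' ((cdf j).inner cv).aestronglyMeasurable
      (Eventually.of_forall fun x => ?_)
    calc _ ≤ ‖fderiv ℝ (fun y => ⟪e j, w y⟫ • w y) x (e j)‖ * ‖v x‖ := norm_inner_le_norm _ _
      _ ≤ 2 * (‖w x‖ * ‖fderiv ℝ w x‖) * M :=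
          mul_le_mul (ndf j x) (hM x) (norm_nonneg _) (by positivity)
      _ = 2 * M * (‖w x‖ * ‖fderiv ℝ w x‖) := by ring
  have s2 : ∀ j, Integrable (fun x => ⟪⟪e j, w x⟫ • w x, fderiv ℝ v x (e j)⟫) volume := fun j => by
    refine (iZ.const_mul B).mono' ((cf j).inner (cdv j)).aestronglyMeasurable
      (Eventually.of_forall fun x => ?_)
    have hdvj : ‖fderiv ℝ v x (e j)‖ ≤ B :=
      ((fderiv ℝ v x).le_opNorm (e j)).trans (by rw [he1, mul_one]; exact hB x)
    calc _ ≤ ‖⟪e j, w x⟫ • w x‖ * ‖fderiv ℝ v x (e j)‖ := norm_inner_le_norm _ _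
      _ ≤ ‖w x‖ * ‖w x‖ * B := mul_le_mul (nf j x) hdvj (norm_nonneg _) (by positivity)
      _ = B * ‖curl v x‖ ^ 2 := by rw [hwdef]; ring
  have s3 : ∀ j, Integrable (fun x => ⟪⟪e j, w x⟫ • w x, v x⟫) volume := fun j => by
    refine (iZ.const_mul M).mono' ((cf j).inner cv).aestronglyMeasurable
      (Eventually.of_forall fun x => ?_)
    calc _ ≤ ‖⟪e j, w x⟫ • w x‖ * ‖v x‖ := norm_inner_le_norm _ _
      _ ≤ ‖w x‖ * ‖w x‖ * M := mul_le_mul (nf j x) (hM x) (norm_nonneg _) (by positivity)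
      _ = M * ‖curl v x‖ ^ 2 := by rw [hwdef]; ring
  -- coordinatewise integration by parts
  have hIBP : ∀ j, ∫ x, ⟪⟪e j, w x⟫ • w x, fderiv ℝ v x (e j)⟫ =
      -∫ x, ⟪fderiv ℝ (fun y => ⟪e j, w y⟫ • w y) x (e j), v x⟫ := fun j =>
    integral_bilinear_fderiv_right_eq_neg_left_of_integrable (μ := volume)
      (B := (innerSL ℝ : (EuclideanSpace ℝ (Fin 3)) →L[ℝ] (EuclideanSpace ℝ (Fin 3)) →L[ℝ] ℝ)) (f := fun y => ⟪e j, w y⟫ • w y) (g := v)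
      (v := e j) (by exact s1 j) (by exact s2 j) (by exact s3 j) (fun x _ => hdf j x)
      (fun x _ => hdv x)
  -- expansion of the stretching density along the coordinates of `w`
  have hexp1 : ∀ x, ⟪w x, fderiv ℝ v x (w x)⟫ = ∑ j, ⟪⟪e j, w x⟫ • w x, fderiv ℝ v x (e j)⟫ :=
    fun x => by
    have hDv : fderiv ℝ v x (w x) = ∑ j, ⟪e j, w x⟫ • fderiv ℝ v x (e j) := by
      conv_lhs => rw [← e.sum_repr' (w x)]
      rw [map_sum]
      simp_rw [map_smul]
    rw [hDv, inner_sum]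
    refine Finset.sum_congr rfl fun j _ => ?_
    rw [real_inner_smul_right, real_inner_smul_left]
  -- `Σⱼ ∂ⱼ(wⱼ w) = (div w) w + Dw w = Dw w`
  have hexp2 : ∀ x, ∑ j, ⟪fderiv ℝ (fun y => ⟪e j, w y⟫ • w y) x (e j), v x⟫ =
      ⟪fderiv ℝ w x (w x), v x⟫ := fun x => by
    have hD : fderiv ℝ w x (w x) = ∑ j, ⟪e j, w x⟫ • fderiv ℝ w x (e j) := by
      conv_lhs => rw [← e.sum_repr' (w x)]
      rw [map_sum]
      simp_rw [map_smul]
    simp_rw [hdfj, ← sum_inner, Finset.sum_add_distrib, ← hD, ← Finset.sum_smul,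
      ← divergence_eq_sum_inner_fderiv e w x, hdivw x, zero_smul, zero_add]
  -- assemble
  have hfun : (fun x => ⟪w x, fderiv ℝ v x (w x)⟫) =
      fun x => ∑ j, ⟪⟪e j, w x⟫ • w x, fderiv ℝ v x (e j)⟫ := funext hexp1
  have iStr : Integrable (fun x => ⟪fderiv ℝ w x (w x), v x⟫) volume :=
    (integrable_finsetSum Finset.univ fun j _ => s1 j).congr (Eventually.of_forall hexp2)
  refine ⟨iStr, ?_⟩
  rw [hfun, integral_finsetSum _ fun j _ => s2 j]
  simp_rw [hIBP]
  rw [Finset.sum_neg_distrib, ← integral_finsetSum _ fun j _ => s1 j]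
  congr 1
  exact integral_congr_ae (Eventually.of_forall hexp2)


/-! ## Channel 1: the longitudinal derivative `∂_ξ ω` -/

/-- The longitudinal palinstrophy density `‖Dω ω‖²/‖ω‖² = ‖∂_ξω‖²` is integrable and its integral is at most
the palinstrophy `∫|∇ω|²_F`. [folklore] -/
theorem integral_longitudinalSq_le (hv : ContDiff ℝ 2 v)
    (iA : Integrable (fun x => frobeniusNormSq (fderiv ℝ (curl v) x))) :
    Integrable (fun x => ‖fderiv ℝ (curl v) x (curl v x)‖ ^ 2 / ‖curl v x‖ ^ 2) ∧
    ∫ x, ‖fderiv ℝ (curl v) x (curl v x)‖ ^ 2 / ‖curl v x‖ ^ 2 ≤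
      ∫ x, frobeniusNormSq (fderiv ℝ (curl v) x) := by
  have hw1 : ContDiff ℝ 1 (curl v) := contDiff_one_curl_of_contDiff_two hv
  have cw : Continuous (curl v) := hw1.continuous
  have cDw : Continuous (fderiv ℝ (curl v)) := hw1.continuous_fderiv one_ne_zero
  have cnum : Continuous fun x => ‖fderiv ℝ (curl v) x (curl v x)‖ ^ 2 := ((cDw.clm_apply cw).norm).pow 2
  have hmeas : AEStronglyMeasurable
      (fun x => ‖fderiv ℝ (curl v) x (curl v x)‖ ^ 2 / ‖curl v x‖ ^ 2) volume :=
    (cnum.measurable.div (cw.norm.pow 2).measurable).aestronglyMeasurable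
  have hle : ∀ x, ‖fderiv ℝ (curl v) x (curl v x)‖ ^ 2 / ‖curl v x‖ ^ 2 ≤
      frobeniusNormSq (fderiv ℝ (curl v) x) := fun x => norm_apply_self_sq_div_le _ _
  have hnn : ∀ x, 0 ≤ ‖fderiv ℝ (curl v) x (curl v x)‖ ^ 2 / ‖curl v x‖ ^ 2 := fun x => by positivity
  have hint : Integrable (fun x => ‖fderiv ℝ (curl v) x (curl v x)‖ ^ 2 / ‖curl v x‖ ^ 2) :=
    iA.mono' hmeas (Eventually.of_forall fun x => by
      rw [Real.norm_of_nonneg (hnn x)]; exact hle x)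
  exact ⟨hint, integral_mono hint iA hle⟩

/-- **RUNG ONE IS LONGITUDINAL (kinematics).** On the slice class (`v ∈ C²` with `|v| ≤ M`, `‖Dv‖ ≤ B`,
`ω = curl v ∈ L²`, `|∇ω|_F ∈ L²`):
`|∫⟪ω, Dv ω⟫| ≤ M · ‖ω‖₂ · ‖∂_ξω‖₂`, `‖∂_ξω‖₂² := ∫‖Dω ω‖²/‖ω‖²` — only the derivative of the vorticity ALONG
ITS OWN DIRECTION produces enstrophy (transport form + Cauchy–Schwarz). [folklore] -/
theorem abs_integral_stretching_le_longitudinal (hv : ContDiff ℝ 2 v) {M B : ℝ}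
    (hM : ∀ x, ‖v x‖ ≤ M) (hB : ∀ x, ‖fderiv ℝ v x‖ ≤ B)
    (iZ : Integrable (fun x => ‖curl v x‖ ^ 2))
    (iA : Integrable (fun x => frobeniusNormSq (fderiv ℝ (curl v) x))) :
    |∫ x, ⟪curl v x, fderiv ℝ v x (curl v x)⟫| ≤
      M * Real.sqrt (∫ x, ‖curl v x‖ ^ 2) *
        Real.sqrt (∫ x, ‖fderiv ℝ (curl v) x (curl v x)‖ ^ 2 / ‖curl v x‖ ^ 2) := by
  obtain ⟨iT, hT⟩ := integral_stretching_eq_neg_integral_inner_convect hv hM hB iZ iA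
  obtain ⟨ig2, -⟩ := integral_longitudinalSq_le hv iA
  rw [hT, abs_neg]
  have hw1 : ContDiff ℝ 1 (curl v) := contDiff_one_curl_of_contDiff_two hv
  have cw : Continuous (curl v) := hw1.continuous
  have cDw : Continuous (fderiv ℝ (curl v)) := hw1.continuous_fderiv one_ne_zero
  have hM0 : 0 ≤ M := (norm_nonneg _).trans (hM 0)
  set g : (EuclideanSpace ℝ (Fin 3)) → ℝ := fun x => ‖fderiv ℝ (curl v) x (curl v x)‖ / ‖curl v x‖ with hgdef
  have hg0 : ∀ x, 0 ≤ g x := fun x => by positivity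
  have hgm : AEStronglyMeasurable g volume :=
    ((cDw.clm_apply cw).norm.measurable.div cw.norm.measurable).aestronglyMeasurable
  have hg2 : Integrable (fun x => g x ^ 2) := by
    refine ig2.congr (Eventually.of_forall fun x => ?_)
    simp only [hgdef, div_pow]
  -- `|⟪Dω ω, v⟫| ≤ M ‖ω‖ g`
  have hpt : ∀ x, |⟪fderiv ℝ (curl v) x (curl v x), v x⟫| ≤ M * (‖curl v x‖ * g x) := fun x => by
    calc |⟪fderiv ℝ (curl v) x (curl v x), v x⟫| ≤ ‖fderiv ℝ (curl v) x (curl v x)‖ * ‖v x‖ :=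
          abs_real_inner_le_norm _ _
      _ ≤ ‖fderiv ℝ (curl v) x (curl v x)‖ * M := mul_le_mul_of_nonneg_left (hM x) (norm_nonneg _)
      _ = M * (‖curl v x‖ * g x) := by rw [hgdef]; simp only; rw [← norm_apply_eq_norm_mul_div]; ring
  have mw : MemLp (fun x => ‖curl v x‖) 2 volume := memLp_two_norm_curl hv iZ
  have mg : MemLp g 2 volume := (memLp_two_iff_integrable_sq hgm).2 hg2
  have iprod : Integrable (fun x => ‖curl v x‖ * g x) := mw.integrable_mul mg
  have h1 : |∫ x, ⟪fderiv ℝ (curl v) x (curl v x), v x⟫| ≤ M * ∫ x, ‖curl v x‖ * g x := by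
    rw [← integral_const_mul]
    exact (abs_integral_le_integral_abs).trans (integral_mono_of_nonneg (Eventually.of_forall fun x =>
      abs_nonneg _) (iprod.const_mul M) (Eventually.of_forall hpt))
  have hcs : ∫ x, ‖curl v x‖ * g x ≤
      Real.sqrt (∫ x, ‖curl v x‖ ^ 2) * Real.sqrt (∫ x, g x ^ 2) :=
    integral_mul_le_sqrt_mul_sqrt (μ := volume) (fun x => norm_nonneg _) hg0
      cw.norm.aestronglyMeasurable hgm iZ hg2
  have hg2eq : ∫ x, g x ^ 2 = ∫ x, ‖fderiv ℝ (curl v) x (curl v x)‖ ^ 2 / ‖curl v x‖ ^ 2 :=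
    integral_congr_ae (Eventually.of_forall fun x => by simp only [hgdef, div_pow])
  calc |∫ x, ⟪fderiv ℝ (curl v) x (curl v x), v x⟫| ≤ M * ∫ x, ‖curl v x‖ * g x := h1
    _ ≤ M * (Real.sqrt (∫ x, ‖curl v x‖ ^ 2) * Real.sqrt (∫ x, g x ^ 2)) :=
        mul_le_mul_of_nonneg_left hcs hM0
    _ = _ := by rw [hg2eq]; ring

/-- **`R² ≤ L`: the depletion ratio is at most the longitudinal palinstrophy fraction.** Same class:
`(∫⟪ω, Dv ω⟫)² ≤ M² · ‖ω‖₂² · ∫‖Dω ω‖²/‖ω‖²`; with `R = ∫⟪ω,Dvω⟫/(M‖ω‖₂‖∇ω‖₂)` and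
`L = (∫‖Dω ω‖²/‖ω‖²)/‖∇ω‖₂² ∈ [0,1]`: `R² ≤ L`. A sequence of fields approaching any positive depletion constant
keeps a fixed fraction of its palinstrophy in LONGITUDINAL variation (`∂_ξ|ω|` and curvature `|ω|κ`). [folklore] -/
theorem sq_integral_stretching_le_longitudinal (hv : ContDiff ℝ 2 v) {M B : ℝ}
    (hM : ∀ x, ‖v x‖ ≤ M) (hB : ∀ x, ‖fderiv ℝ v x‖ ≤ B)
    (iZ : Integrable (fun x => ‖curl v x‖ ^ 2))
    (iA : Integrable (fun x => frobeniusNormSq (fderiv ℝ (curl v) x))) :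
    (∫ x, ⟪curl v x, fderiv ℝ v x (curl v x)⟫) ^ 2 ≤
      M ^ 2 * (∫ x, ‖curl v x‖ ^ 2) * ∫ x, ‖fderiv ℝ (curl v) x (curl v x)‖ ^ 2 / ‖curl v x‖ ^ 2 := by
  have h := abs_integral_stretching_le_longitudinal hv hM hB iZ iA
  obtain ⟨ig2, -⟩ := integral_longitudinalSq_le hv iA
  have hZ0 : 0 ≤ ∫ x, ‖curl v x‖ ^ 2 := integral_nonneg fun x => by positivity
  have hL0 : 0 ≤ ∫ x, ‖fderiv ℝ (curl v) x (curl v x)‖ ^ 2 / ‖curl v x‖ ^ 2 :=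
    integral_nonneg fun x => by positivity
  have hM0 : 0 ≤ M := (norm_nonneg _).trans (hM 0)
  have hrhs : 0 ≤ M * Real.sqrt (∫ x, ‖curl v x‖ ^ 2) *
      Real.sqrt (∫ x, ‖fderiv ℝ (curl v) x (curl v x)‖ ^ 2 / ‖curl v x‖ ^ 2) := by positivity
  calc (∫ x, ⟪curl v x, fderiv ℝ v x (curl v x)⟫) ^ 2
      = |∫ x, ⟪curl v x, fderiv ℝ v x (curl v x)⟫| ^ 2 := (sq_abs _).symm
    _ ≤ (M * Real.sqrt (∫ x, ‖curl v x‖ ^ 2) *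
          Real.sqrt (∫ x, ‖fderiv ℝ (curl v) x (curl v x)‖ ^ 2 / ‖curl v x‖ ^ 2)) ^ 2 :=
        pow_le_pow_left₀ (abs_nonneg _) h 2
    _ = _ := by
        rw [mul_pow, mul_pow, Real.sq_sqrt hZ0, Real.sq_sqrt hL0]


end Channels

end Summit.NavierStokesRegularity.NavierStokesRegularity.Theorems.DepletionLadder

end
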